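import Summits.BirchSwinnertonDyer.BirchSwinnertonDyer.Theorems.GenusKolyvaginAtTwoTorsionCellSELTwistReduce
import HarnessLib

/-!
# SEL (iso-class Selmer pair law), IV: the torsion-times-support classes that ARE Selmer classes of the twist

Crux R″ `RankOneTwoTorsionResidualAtTwo` (stmt-27478), LINE 49 «full_vertex», SUPPORT stub SEL
`IsoClassSelmerPairLawAtTwo`, the `C₀ = E₀^{(M)}` half (pen bsd-idea-1 memo #3 §4, converse direction).  Setting as in
parts II–III: `E/ℚ` with rational `2`-torsion `e₁, e₂, e₃`; `S ∋ 2` a finite set of primes supporting `N_E` and the root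
differences; `Q` an iso-class set of full-admissible primes `≡ 3 (mod 4)` of even size, disjoint from `S`, with common
bit `ε = qr_q(e₂ − e₁)`; `M = ∏_{q∈Q} q`.

* **`twoDescentClass_torsion_mul_support_mem_selmerGroup`** — let `c_E(t₁, t₂) ∈ Sel⁽²⁾(E/ℚ)` with `t₁, t₂` units at
  the primes of `Q` whose residue bits `τ₁ = qr_q(t₁)`, `τ₂ = qr_q(t₂)` do not depend on `q ∈ Q` (e.g. a torsion pair of
  `E`), and let `Q_a, Q_b ⊆ Q` have even size with indicator vectors `p_a, p_b` solving the ROW SYSTEM of part II,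
  `Σ_{i≠j} [−i/j] p_a(i) + (g_j + ε) p_a(j) + p_b(j) = τ₁`, `Σ_{i≠j} [−i/j] p_b(i) + (g_j + ε + 1) p_b(j) + p_a(j) = τ₂`
  (`j ∈ Q`).  Then `c_{E^{(M)}}(t₁ ∏_{Q_a} i, t₂ ∏_{Q_b} i) ∈ Sel⁽²⁾(E^{(M)}/ℚ)`: at `ℓ ∈ S` and `∞` by transfer from `E`
  (`M`, `∏_{Q_a}`, `∏_{Q_b}` local squares), off `S ∪ Q` by good reduction, and at `j ∈ Q` because the row equations
  say exactly that, after adding the `2`-torsion class of `E^{(M)}` with the same `j`-parities, both components are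
  `j`-adic squares (the `I₀*` local condition at a twisting prime = image of the twisted `2`-torsion).

With part III this identifies `Sel⁽²⁾(E^{(M)}/ℚ)` with the solution set `{(τ, p_a, p_b)}` of the row system (part V counts
it).  Everything is proved; no LINE 49 statement is restated; BSD is not advanced by this file alone.

## References

* [SilvermanAEC2009] J. H. Silverman, *The Arithmetic of Elliptic Curves*, 2nd ed., Prop. X.1.4, Prop. X.4.9.
* [MazurRubin2010] B. Mazur, K. Rubin, Invent. Math. 181 (2010), Lemma 2.10, Lemma 2.11.
* [Kane2013SelmerTwists] D. M. Kane, Algebra Number Theory 7 (2013), §2.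
-/

noncomputable section

open scoped Classical

namespace Summit.BirchSwinnertonDyer.BirchSwinnertonDyer.Theorems.GenusKolyvaginAtTwo.TorsionCellSEL

open WeierstrassCurve WeierstrassCurve.Affine WeierstrassCurve.Affine.Point
open Literature.NumberTheory.GaloisRepresentations Literature.NumberTheory.EllipticCurves Field
open Literature.NumberTheory.EllipticCurves.TwoDescentLocal
open Literature.NumberTheory.EllipticCurves.KramerTwoDescent
open Summit.BirchSwinnertonDyer.BirchSwinnertonDyer.Theorems.GenusKolyvaginAtTwo.TorsionCellD0
open IsDedekindDomain NumberField Rat.HeightOneSpectrum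

section Converse

variable (E : WeierstrassCurve ℚ) [E.IsElliptic] {e₁ e₂ e₃ : ℚ} (S Q : Finset ℕ)

/-- An `S`-supported square-free kernel `ε ∏_{ℓ∈T} ℓ` as an integer. [folklore] -/
private theorem kernel_intCast {T : Finset ℕ} {ε : ℚ} (hε : ε = 1 ∨ ε = -1) :
    ∃ m : ℤ, (m : ℚ) = ε * ∏ ℓ ∈ T, (ℓ : ℚ) ∧ ∀ q : ℕ, q.Prime → q ∉ T → (∀ ℓ ∈ T, ℓ.Prime) → ¬ (q : ℤ) ∣ m := by
  have hεZ : ∃ e : ℤ, (e : ℚ) = ε ∧ (e = 1 ∨ e = -1) := by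
    rcases hε with h1 | h1
    · exact ⟨1, by rw [h1]; norm_num, Or.inl rfl⟩
    · exact ⟨-1, by rw [h1]; norm_num, Or.inr rfl⟩
  obtain ⟨e, he, he1⟩ := hεZ
  refine ⟨e * ∏ ℓ ∈ T, (ℓ : ℤ), by rw [← he]; push_cast; rfl, ?_⟩
  intro q hq hqT hTp hdvd
  have hqprime : Prime (q : ℤ) := Nat.prime_iff_prime_int.mp hq
  rcases hqprime.dvd_or_dvd hdvd with h1 | h2
  · rcases he1 with rfl | rfl
    · exact hq.one_lt.ne' (by exact_mod_cast Int.eq_one_of_dvd_one (by norm_num) h1)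
    · exact hq.one_lt.ne' (by exact_mod_cast Int.eq_one_of_dvd_one (by norm_num) (Int.dvd_neg.mpr h1))
  · obtain ⟨ℓ, hℓT, hℓ⟩ := (Prime.dvd_finsetProd_iff hqprime _).mp h2
    have := (Nat.prime_dvd_prime_iff_eq hq (hTp ℓ hℓT)).mp (by exact_mod_cast hℓ)
    exact hqT (this ▸ hℓT)

/-- **An integer representative, prime to every `ℓ ∉ S ∪ Q_a`, of the class `[t ∏_{Q_a} i]`** for a component `t` of a
Selmer class of `E` (`S`-supported kernel) and `Q_a ⊆ Q`. [cite: SilvermanAEC2009, Prop. X.1.4] -/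
private theorem exists_intCast_of_selmer_component (h : E.toAffine.SplitTwoTorsion e₁ e₂ e₃) (hS : ∀ ℓ ∈ S, ℓ.Prime)
    (hgood : ∀ ℓ : ℕ, (hℓ : ℓ.Prime) → ℓ ∉ S → haveI : Fact ℓ.Prime := ⟨hℓ⟩;
      padicValRat ℓ (e₁ - e₂) = 0 ∧ padicValRat ℓ (e₁ - e₃) = 0)
    (hQ : ∀ q ∈ Q, q.Prime) {c : galH1Torsion E 2} (hc : c ∈ E.selmerGroup 2) (t : ℚˣ)
    (ht : kummerEquiv ℚ 2 (E.twoTorsionCharH1 h c) = Additive.ofMul (QuotientGroup.mk t))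
    {Qa : Finset ℕ} (hQa : Qa ⊆ Q) (hpa0 : ∏ i ∈ Qa, (i : ℚ) ≠ 0) :
    ∃ m : ℤ, ∃ hm0 : (m : ℚ) ≠ 0, (QuotientGroup.mk (t * Units.mk0 _ hpa0) : SqUnits ℚ) = QuotientGroup.mk (Units.mk0 (m : ℚ) hm0) ∧
      ∀ ℓ : ℕ, ℓ.Prime → ℓ ∉ S → ℓ ∉ Q → ¬ (ℓ : ℤ) ∣ m := by
  obtain ⟨T, hTS, ε, hε, -, hg, hmk, -, -⟩ := E.exists_kernel_of_mem_selmerGroup h S hS hgood hc t ht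
  have hTp : ∀ ℓ ∈ T, ℓ.Prime := fun ℓ hℓ => hS ℓ (hTS hℓ)
  obtain ⟨m, hm, hmdiv⟩ := kernel_intCast (T := T) hε
  have hm0 : (m : ℚ) ≠ 0 := by rw [hm]; exact hg
  refine ⟨m * ∏ i ∈ Qa, (i : ℤ), by push_cast; exact mul_ne_zero hm0 hpa0, ?_, ?_⟩
  · have hu : (Units.mk0 (((m * ∏ i ∈ Qa, (i : ℤ) : ℤ)) : ℚ) (by push_cast; exact mul_ne_zero hm0 hpa0) : ℚˣ) =
        Units.mk0 _ hg * Units.mk0 _ hpa0 :=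
      Units.ext (by rw [Units.val_mul, Units.val_mk0, Units.val_mk0, Units.val_mk0, ← hm]; push_cast; rfl)
    rw [hu, QuotientGroup.mk_mul, QuotientGroup.mk_mul, hmk]
  · intro ℓ hℓ hℓS hℓQ hdvd
    have hℓprime : Prime (ℓ : ℤ) := Nat.prime_iff_prime_int.mp hℓ
    rcases hℓprime.dvd_or_dvd hdvd with h1 | h2
    · exact hmdiv ℓ hℓ (fun hT => hℓS (hTS hT)) hTp h1
    · obtain ⟨i, hi, hℓi⟩ := (Prime.dvd_finsetProd_iff hℓprime _).mp h2
      have := (Nat.prime_dvd_prime_iff_eq hℓ (hQ i (hQa hi))).mp (by exact_mod_cast hℓi)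
      exact hℓQ (this ▸ hQa hi)

/-- `𝔽₂` arithmetic used at a twisting prime. [folklore] -/
private theorem zmod2_cases (x : ZMod 2) : x = 0 ∨ x = 1 := by revert x; decide

/-- **The torsion-times-support classes solving the row system are Selmer classes of the iso-class twist.**  Setting of
the module docstring; `c_E(t₁,t₂) ∈ Sel⁽²⁾(E/ℚ)` with `t₁, t₂` units at the primes of `Q` with constant residue bits
`τ₁, τ₂` on `Q`; `Q_a, Q_b ⊆ Q` of even size whose indicator vectors solve the row system with right-hand sides `τ₁, τ₂`.
Then `c_{E^{(M)}}(t₁ ∏_{Q_a} i, t₂ ∏_{Q_b} i) ∈ Sel⁽²⁾(E^{(M)}/ℚ)`.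
[cite: SilvermanAEC2009, Prop. X.1.4, Prop. X.4.9] [cite: MazurRubin2010, Lemma 2.10, Lemma 2.11]
[cite: Kane2013SelmerTwists, §2] -/
theorem twoDescentClass_torsion_mul_support_mem_selmerGroup (h : E.toAffine.SplitTwoTorsion e₁ e₂ e₃)
    (hS : ∀ ℓ ∈ S, ℓ.Prime) (h2S : 2 ∈ S)
    (hgood : ∀ ℓ : ℕ, (hℓ : ℓ.Prime) → ℓ ∉ S → haveI : Fact ℓ.Prime := ⟨hℓ⟩;
      padicValRat ℓ (e₁ - e₂) = 0 ∧ padicValRat ℓ (e₁ - e₃) = 0 ∧ padicValRat ℓ (e₂ - e₃) = 0)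
    (hN : ∀ ℓ : ℕ, ℓ.Prime → ℓ ∉ S → ¬ ℓ ∣ E.conductorNorm ℤ)
    (hQ : ∀ q ∈ Q, q.Prime) (hQS : ∀ q ∈ Q, q ∉ S) (hQ4 : ∀ q ∈ Q, q % 4 = 3) (hk : Even Q.card)
    (hiso8 : ∀ q ∈ Q, ∀ q' ∈ Q, q % 8 = q' % 8)
    (hisoS : ∀ q ∈ Q, ∀ q' ∈ Q, ∀ ℓ ∈ S, (hℓ : ℓ.Prime) → ℓ ≠ 2 → haveI : Fact ℓ.Prime := ⟨hℓ⟩;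
      legendreSym ℓ ((q : ℤ) * q') = 1)
    (hadm : ∀ q ∈ Q, (hq : q.Prime) → haveI : Fact q.Prime := ⟨hq⟩;
      qrBit q ((e₁ - e₂) * (e₁ - e₃)) = 1 ∧ qrBit q ((e₂ - e₁) * (e₂ - e₃)) = 1)
    {ε : ZMod 2} (hε : ∀ q ∈ Q, (hq : q.Prime) → haveI : Fact q.Prime := ⟨hq⟩; qrBit q (e₂ - e₁) = ε)
    {d : ℚ} (hd : d = ∏ q ∈ Q, (q : ℚ)) [(E.quadraticTwist d).IsElliptic]
    {t₁ t₂ : ℚˣ} (ht : E.twoDescentClass h t₁ t₂ ∈ E.selmerGroup 2)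
    {τ₁ τ₂ : ZMod 2}
    (hτ : ∀ q ∈ Q, (hq : q.Prime) → haveI : Fact q.Prime := ⟨hq⟩;
      parityBit q (t₁ : ℚ) = 0 ∧ parityBit q (t₂ : ℚ) = 0 ∧ qrBit q (t₁ : ℚ) = τ₁ ∧ qrBit q (t₂ : ℚ) = τ₂)
    {Qa Qb : Finset ℕ} (hQa : Qa ⊆ Q) (hQb : Qb ⊆ Q) (hQak : Even Qa.card) (hQbk : Even Qb.card)
    (hrows : ∀ j ∈ Q,
      ((∑ i ∈ Q.erase j, (if jacobiSym (-(i : ℤ)) j = -1 then (1 : ZMod 2) else 0) * (if i ∈ Qa then 1 else 0)) +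
          ((∑ i ∈ Q.erase j, (if jacobiSym (-(i : ℤ)) j = -1 then (1 : ZMod 2) else 0)) + ε) * (if j ∈ Qa then 1 else 0) +
          (if j ∈ Qb then 1 else 0) = τ₁) ∧
      ((∑ i ∈ Q.erase j, (if jacobiSym (-(i : ℤ)) j = -1 then (1 : ZMod 2) else 0) * (if i ∈ Qb then 1 else 0)) +
          ((∑ i ∈ Q.erase j, (if jacobiSym (-(i : ℤ)) j = -1 then (1 : ZMod 2) else 0)) + ε + 1) * (if j ∈ Qb then 1 else 0) +
          (if j ∈ Qa then 1 else 0) = τ₂))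
    (hpa0 : ∏ i ∈ Qa, (i : ℚ) ≠ 0) (hpb0 : ∏ i ∈ Qb, (i : ℚ) ≠ 0) :
    (E.quadraticTwist d).twoDescentClass (h.quadraticTwist d) (t₁ * Units.mk0 _ hpa0) (t₂ * Units.mk0 _ hpb0) ∈
      selmerGroup (E.quadraticTwist d) 2 := by
  have h' := h.quadraticTwist d
  have hQ0 : ∀ q ∈ Q, (q : ℚ) ≠ 0 := fun q hq => by exact_mod_cast (hQ q hq).ne_zero
  have hd0 : d ≠ 0 := by rw [hd]; exact Finset.prod_ne_zero_iff.mpr hQ0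
  have he12 : e₁ - e₂ ≠ 0 := sub_ne_zero.mpr h.ne₁₂
  have he21 : e₂ - e₁ ≠ 0 := sub_ne_zero.mpr h.ne₁₂.symm
  have he13 : e₁ - e₃ ≠ 0 := sub_ne_zero.mpr h.ne₁₃
  have he31 : e₃ - e₁ ≠ 0 := sub_ne_zero.mpr h.ne₁₃.symm
  have he23 : e₂ - e₃ ≠ 0 := sub_ne_zero.mpr h.ne₂₃
  have he32 : e₃ - e₂ ≠ 0 := sub_ne_zero.mpr h.ne₂₃.symm
  -- the split `c(t₁ ∏, t₂ ∏) = c(t₁, t₂) + c(∏, ∏)`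
  have hsplit : (E.quadraticTwist d).twoDescentClass h' (t₁ * Units.mk0 _ hpa0) (t₂ * Units.mk0 _ hpb0) =
      (E.quadraticTwist d).twoDescentClass h' t₁ t₂ + (E.quadraticTwist d).twoDescentClass h' (Units.mk0 _ hpa0) (Units.mk0 _ hpb0) :=
    twoDescentClass_mul _ h' _ _ _ _
  -- local Selmer condition of the torsion part of `E` at every place
  have htloc := (mem_selmerGroup_iff _ _ _).mp ht
  -- integer representatives of the two components, prime to every `ℓ ∉ S ∪ Q`
  obtain ⟨mA, hmA0, hmkA, hmAdiv⟩ := exists_intCast_of_selmer_component E S Q h hS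
    (fun ℓ hℓ hℓS => ⟨(hgood ℓ hℓ hℓS).1, (hgood ℓ hℓ hℓS).2.1⟩) hQ ht t₁
    (E.kummerEquiv_twoTorsionCharH1_twoDescentClass h t₁ t₂) hQa hpa0
  obtain ⟨mB, hmB0, hmkB, hmBdiv⟩ := exists_intCast_of_selmer_component E S Q h.swap₁₂ hS
    (fun ℓ hℓ hℓS => ⟨by rw [← neg_sub, padicValRat.neg]; exact (hgood ℓ hℓ hℓS).1, (hgood ℓ hℓ hℓS).2.2⟩) hQ ht t₂
    (E.kummerEquiv_twoTorsionCharH1_swap_twoDescentClass h t₁ t₂) hQb hpb0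
  rw [mem_selmerGroup_iff]
  refine ⟨fun v => ?_, fun w => ?_⟩
  · by_cases hvS : (primesEquiv v : ℕ) ∈ S
    · -- `ℓ ∈ S`: transfer from `E` plus a locally trivial support class
      have hsqd : IsSquare (algebraMap ℚ (v.adicCompletion ℚ) d) := by
        rw [hd]; exact isSquare_prod_adicCompletion_of_isoClass S Q hQ hQS hQ4 hiso8 hisoS (subset_refl Q) hk v hvS
      rw [hsplit]
      refine add_mem ?_ ?_
      · exact (E.twoDescentClass_quadraticTwist_mem_selmerLocalKer_iff (v.adicCompletion ℚ)
          (charZero_of_injective_algebraMap (algebraMap ℚ _).injective) h hsqd t₁ t₂).mpr (htloc.1 v)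
      · exact twoDescentClass_mem_selmerLocalKer_of_isSquare (E.quadraticTwist d) h' _
          (charZero_of_injective_algebraMap (algebraMap ℚ _).injective) _ _
          (isSquare_prod_adicCompletion_of_isoClass S Q hQ hQS hQ4 hiso8 hisoS hQa hQak v hvS)
          (isSquare_prod_adicCompletion_of_isoClass S Q hQ hQS hQ4 hiso8 hisoS hQb hQbk v hvS)
    · have hℓ := (primesEquiv v).2
      haveI : Fact (primesEquiv v : ℕ).Prime := ⟨hℓ⟩
      have hℓ2 : (primesEquiv v : ℕ) ≠ 2 := fun h2 => hvS (h2 ▸ h2S)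
      by_cases hvQ : (primesEquiv v : ℕ) ∈ Q
      · -- `j ∈ Q`: the row equations = the `I₀*` local condition
        set j : ℕ := (primesEquiv v : ℕ) with hjdef
        obtain ⟨hpt₁, hpt₂, hτ₁, hτ₂⟩ := hτ j hvQ hℓ
        obtain ⟨hδ₁, hδ₂⟩ := hadm j hvQ hℓ
        have hεj := hε j hvQ hℓ
        obtain ⟨g12, g13, g23⟩ := hgood j hℓ hvS
        obtain ⟨r1, r2⟩ := hrows j hvQ
        have hm1 : qrBit j (-1 : ℚ) = 1 := qrBit_neg_one_eq_one_of_emod_four (hQ4 j hvQ)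
        -- symbols of `d` and of the torsion values of `E^{(d)}` at `j`
        have hvd : padicValRat j d = 1 := by rw [hd, padicValRat_prod_primes hQ j, if_pos hvQ]
        have hcard : ((Q.erase j).card : ZMod 2) = 1 := by
          rw [Finset.card_erase_of_mem hvQ]
          obtain ⟨r, hr⟩ := hk
          have hpos : 0 < Q.card := Finset.card_pos.mpr ⟨j, hvQ⟩
          have : Q.card - 1 = 2 * (r - 1) + 1 := by omega
          rw [this, Nat.cast_add, Nat.cast_mul, show ((2 : ℕ) : ZMod 2) = 0 by decide, zero_mul, zero_add, Nat.cast_one]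
        have hqd : qrBit j d = 1 + ∑ i ∈ Q.erase j, (if jacobiSym (-(i : ℤ)) j = -1 then (1 : ZMod 2) else 0) := by
          rw [hd, qrBit_prod_natCast_eq Q hQ (hQ4 j hvQ) (subset_refl Q), hcard]
        have hq12 : qrBit j (e₁ - e₂) = 1 + ε := by rw [← neg_sub, qrBit_neg (p := j) he21, hm1, hεj]
        have hq13 : qrBit j (e₁ - e₃) = ε := by
          have := hδ₁; rw [qrBit_mul j he12 he13, hq12] at this
          revert this; generalize qrBit j (e₁ - e₃) = x; revert x; rcases zmod2_cases ε with h0 | h0 <;> subst h0 <;> decide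
        have hq31 : qrBit j (e₃ - e₁) = 1 + ε := by rw [← neg_sub, qrBit_neg (p := j) he13, hm1, hq13]
        have hq23 : qrBit j (e₂ - e₃) = 1 + ε := by
          have := hδ₂; rw [qrBit_mul j he21 he23, hεj] at this
          revert this; generalize qrBit j (e₂ - e₃) = x; revert x; rcases zmod2_cases ε with h0 | h0 <;> subst h0 <;> decide
        have hq32 : qrBit j (e₃ - e₂) = ε := by
          rw [← neg_sub, qrBit_neg (p := j) he23, hm1, hq23]
          rcases zmod2_cases ε with h0 | h0 <;> subst h0 <;> decide
        -- parities and residues of the supports at `j`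
        have hQa_p : ∀ i ∈ Qa, i.Prime := fun i hi => hQ i (hQa hi)
        have hQb_p : ∀ i ∈ Qb, i.Prime := fun i hi => hQ i (hQb hi)
        have hpA : parityBit j (∏ i ∈ Qa, (i : ℚ)) = (if j ∈ Qa then 1 else 0) := parityBit_prod_primes hQa_p j
        have hpB : parityBit j (∏ i ∈ Qb, (i : ℚ)) = (if j ∈ Qb then 1 else 0) := parityBit_prod_primes hQb_p j
        have hrA := qrBit_prod_natCast_eq Q hQ (hQ4 j hvQ) hQa (j := j)
        have hrB := qrBit_prod_natCast_eq Q hQ (hQ4 j hvQ) hQb (j := j)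
        -- `#(Q_a∖j) + Σ_{Q_a∖j} G = |Q_a| + [j∈Q_a] + Σ_{i∈Q∖j} G·𝟙_{Q_a}` with `|Q_a| = 0`
        have hsum_ind : ∀ {R : Finset ℕ}, R ⊆ Q → Even R.card →
            ((R.erase j).card : ZMod 2) + ∑ i ∈ R.erase j, (if jacobiSym (-(i : ℤ)) j = -1 then (1 : ZMod 2) else 0) =
              (if j ∈ R then 1 else 0) +
                ∑ i ∈ Q.erase j, (if jacobiSym (-(i : ℤ)) j = -1 then (1 : ZMod 2) else 0) * (if i ∈ R then 1 else 0) := by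
          intro R hR hRk
          have hcardR : ((R.erase j).card : ZMod 2) = (if j ∈ R then 1 else 0) := by
            obtain ⟨r, hr⟩ := hRk
            by_cases hjR : j ∈ R
            · rw [if_pos hjR, Finset.card_erase_of_mem hjR]
              have hpos : 0 < R.card := Finset.card_pos.mpr ⟨j, hjR⟩
              have : R.card - 1 = 2 * (r - 1) + 1 := by omega
              rw [this, Nat.cast_add, Nat.cast_mul, show ((2 : ℕ) : ZMod 2) = 0 by decide, zero_mul, zero_add, Nat.cast_one]
            · rw [if_neg hjR, Finset.erase_eq_of_notMem hjR, hr, ← two_mul, Nat.cast_mul,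
                show ((2 : ℕ) : ZMod 2) = 0 by decide, zero_mul]
          rw [hcardR]
          congr 1
          have hset : (Q.erase j).filter (· ∈ R) = R.erase j := by
            ext i; simp only [Finset.mem_filter, Finset.mem_erase]
            constructor
            · rintro ⟨⟨hij, -⟩, hiR⟩; exact ⟨hij, hiR⟩
            · rintro ⟨hij, hiR⟩; exact ⟨⟨hij, hR hiR⟩, hiR⟩
          rw [← hset, Finset.sum_filter]
          refine Finset.sum_congr rfl fun i _ => ?_
          split_ifs <;> simp
        have hresA : qrBit j (∏ i ∈ Qa, (i : ℚ)) = (if j ∈ Qa then 1 else 0) +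
            ∑ i ∈ Q.erase j, (if jacobiSym (-(i : ℤ)) j = -1 then (1 : ZMod 2) else 0) * (if i ∈ Qa then 1 else 0) := by
          rw [hrA, hsum_ind hQa hQak]
        have hresB : qrBit j (∏ i ∈ Qb, (i : ℚ)) = (if j ∈ Qb then 1 else 0) +
            ∑ i ∈ Q.erase j, (if jacobiSym (-(i : ℤ)) j = -1 then (1 : ZMod 2) else 0) * (if i ∈ Qb then 1 else 0) := by
          rw [hrB, hsum_ind hQb hQbk]
        -- abbreviations
        set G : ZMod 2 := ∑ i ∈ Q.erase j, (if jacobiSym (-(i : ℤ)) j = -1 then (1 : ZMod 2) else 0) with hG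
        set GA : ZMod 2 := ∑ i ∈ Q.erase j, (if jacobiSym (-(i : ℤ)) j = -1 then (1 : ZMod 2) else 0) * (if i ∈ Qa then 1 else 0)
          with hGA
        set GB : ZMod 2 := ∑ i ∈ Q.erase j, (if jacobiSym (-(i : ℤ)) j = -1 then (1 : ZMod 2) else 0) * (if i ∈ Qb then 1 else 0)
          with hGB
        -- the square test at `j`
        have sq : ∀ {x : ℚ}, x ≠ 0 → parityBit j x = 0 → qrBit j x = 0 → IsSquare (algebraMap ℚ (v.adicCompletion ℚ) x) :=
          fun hx hp hq => isSquare_algebraMap_adicCompletion_of_bits v hjdef.symm hℓ2 hx hp hq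
        have hA0 : (t₁ : ℚ) * ∏ i ∈ Qa, (i : ℚ) ≠ 0 := mul_ne_zero t₁.ne_zero hpa0
        have hB0 : (t₂ : ℚ) * ∏ i ∈ Qb, (i : ℚ) ≠ 0 := mul_ne_zero t₂.ne_zero hpb0
        have hpd : parityBit j d = 1 := by rw [parityBit, hvd, Int.cast_one]
        have hpd2 : parityBit j (d ^ 2) = 0 := by
          rw [pow_two, parityBit_mul hd0 hd0, hpd]; decide
        have hp12 : parityBit j (e₁ - e₂) = 0 := by rw [parityBit, g12, Int.cast_zero]
        have hp13 : parityBit j (e₁ - e₃) = 0 := by rw [parityBit, g13, Int.cast_zero]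
        have hp23 : parityBit j (e₂ - e₃) = 0 := by rw [parityBit, g23, Int.cast_zero]
        have hp21 : parityBit j (e₂ - e₁) = 0 := by rw [parityBit, ← neg_sub, padicValRat.neg, g12, Int.cast_zero]
        have hp31 : parityBit j (e₃ - e₁) = 0 := by rw [parityBit, ← neg_sub, padicValRat.neg, g13, Int.cast_zero]
        have hp32 : parityBit j (e₃ - e₂) = 0 := by rw [parityBit, ← neg_sub, padicValRat.neg, g23, Int.cast_zero]
        -- the four parity cases `([j∈Q_a], [j∈Q_b])`
        by_cases hjA : j ∈ Qa <;> by_cases hjB : j ∈ Qb <;>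
          simp only [hjA, hjB, if_true, if_false] at r1 r2 hpA hpB hresA hresB
        · -- `(1,1)`: exhibit `T₃' = (d(e₃−e₁), d(e₃−e₂))`
          refine twoDescentClass_mem_selmerLocalKer_of_isSquare_T₃ (E.quadraticTwist d) h' _
            (charZero_of_injective_algebraMap (algebraMap ℚ _).injective) _ _ ?_ ?_
          · rw [show d * e₃ - d * e₁ = d * (e₃ - e₁) by ring, Units.val_mul, Units.val_mk0]
            refine sq (mul_ne_zero hA0 (mul_ne_zero hd0 he31)) ?_ ?_
            · rw [parityBit_mul hA0 (mul_ne_zero hd0 he31), parityBit_mul t₁.ne_zero hpa0, parityBit_mul hd0 he31, hpt₁, hpA,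
                hpd, hp31]
              decide
            · rw [qrBit_mul j hA0 (mul_ne_zero hd0 he31), qrBit_mul j t₁.ne_zero hpa0, qrBit_mul j hd0 he31, hτ₁, hresA, hqd,
                hq31]
              linear_combination (norm := skip) r1
              ring_nf
              try reduce_mod_char
              try simp
          · rw [show d * e₃ - d * e₂ = d * (e₃ - e₂) by ring, Units.val_mul, Units.val_mk0]
            refine sq (mul_ne_zero hB0 (mul_ne_zero hd0 he32)) ?_ ?_
            · rw [parityBit_mul hB0 (mul_ne_zero hd0 he32), parityBit_mul t₂.ne_zero hpb0, parityBit_mul hd0 he32, hpt₂, hpB,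
                hpd, hp32]
              decide
            · rw [qrBit_mul j hB0 (mul_ne_zero hd0 he32), qrBit_mul j t₂.ne_zero hpb0, qrBit_mul j hd0 he32, hτ₂, hresB, hqd,
                hq32]
              linear_combination (norm := skip) r2
              ring_nf
              try reduce_mod_char
              try simp
        · -- `(1,0)`: exhibit `T₂' = (d(e₂−e₁), d²δ₂)`
          refine twoDescentClass_mem_selmerLocalKer_of_isSquare_T₂ (E.quadraticTwist d) h' _
            (charZero_of_injective_algebraMap (algebraMap ℚ _).injective) _ _ ?_ ?_
          · rw [show d * e₂ - d * e₁ = d * (e₂ - e₁) by ring, Units.val_mul, Units.val_mk0]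
            refine sq (mul_ne_zero hA0 (mul_ne_zero hd0 he21)) ?_ ?_
            · rw [parityBit_mul hA0 (mul_ne_zero hd0 he21), parityBit_mul t₁.ne_zero hpa0, parityBit_mul hd0 he21, hpt₁, hpA,
                hpd, hp21]
              decide
            · rw [qrBit_mul j hA0 (mul_ne_zero hd0 he21), qrBit_mul j t₁.ne_zero hpa0, qrBit_mul j hd0 he21, hτ₁, hresA, hqd,
                hεj]
              linear_combination (norm := skip) r1
              ring_nf
              try reduce_mod_char
              try simp
          · rw [show (d * e₂ - d * e₁) * (d * e₂ - d * e₃) = d ^ 2 * ((e₂ - e₁) * (e₂ - e₃)) by ring, Units.val_mul,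
              Units.val_mk0]
            refine sq (mul_ne_zero hB0 (mul_ne_zero (pow_ne_zero 2 hd0) (mul_ne_zero he21 he23))) ?_ ?_
            · rw [parityBit_mul hB0 (mul_ne_zero (pow_ne_zero 2 hd0) (mul_ne_zero he21 he23)), parityBit_mul t₂.ne_zero hpb0,
                parityBit_mul (pow_ne_zero 2 hd0) (mul_ne_zero he21 he23), hpt₂, hpB, hpd2, parityBit_mul he21 he23, hp21, hp23]
              decide
            · rw [qrBit_mul j hB0 (mul_ne_zero (pow_ne_zero 2 hd0) (mul_ne_zero he21 he23)), qrBit_mul j t₂.ne_zero hpb0,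
                qrBit_mul j (pow_ne_zero 2 hd0) (mul_ne_zero he21 he23), qrBit_sq, hτ₂, hresB, hδ₂]
              linear_combination (norm := skip) r2
              ring_nf
              try reduce_mod_char
              try simp
        · -- `(0,1)`: exhibit `T₁' = (d²δ₁, d(e₁−e₂))`
          refine twoDescentClass_mem_selmerLocalKer_of_isSquare_T₁ (E.quadraticTwist d) h' _
            (charZero_of_injective_algebraMap (algebraMap ℚ _).injective) _ _ ?_ ?_
          · rw [show (d * e₁ - d * e₂) * (d * e₁ - d * e₃) = d ^ 2 * ((e₁ - e₂) * (e₁ - e₃)) by ring, Units.val_mul,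
              Units.val_mk0]
            refine sq (mul_ne_zero hA0 (mul_ne_zero (pow_ne_zero 2 hd0) (mul_ne_zero he12 he13))) ?_ ?_
            · rw [parityBit_mul hA0 (mul_ne_zero (pow_ne_zero 2 hd0) (mul_ne_zero he12 he13)), parityBit_mul t₁.ne_zero hpa0,
                parityBit_mul (pow_ne_zero 2 hd0) (mul_ne_zero he12 he13), hpt₁, hpA, hpd2, parityBit_mul he12 he13, hp12, hp13]
              decide
            · rw [qrBit_mul j hA0 (mul_ne_zero (pow_ne_zero 2 hd0) (mul_ne_zero he12 he13)), qrBit_mul j t₁.ne_zero hpa0,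
                qrBit_mul j (pow_ne_zero 2 hd0) (mul_ne_zero he12 he13), qrBit_sq, hτ₁, hresA, hδ₁]
              linear_combination (norm := skip) r1
              ring_nf
              try reduce_mod_char
              try simp
          · rw [show d * e₁ - d * e₂ = d * (e₁ - e₂) by ring, Units.val_mul, Units.val_mk0]
            refine sq (mul_ne_zero hB0 (mul_ne_zero hd0 he12)) ?_ ?_
            · rw [parityBit_mul hB0 (mul_ne_zero hd0 he12), parityBit_mul t₂.ne_zero hpb0, parityBit_mul hd0 he12, hpt₂, hpB,
                hpd, hp12]
              decide
            · rw [qrBit_mul j hB0 (mul_ne_zero hd0 he12), qrBit_mul j t₂.ne_zero hpb0, qrBit_mul j hd0 he12, hτ₂, hresB, hqd,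
                hq12]
              linear_combination (norm := skip) r2
              ring_nf
              try reduce_mod_char
              try simp
        · -- `(0,0)`: no exhibit needed, both components are `j`-adic squares
          refine twoDescentClass_mem_selmerLocalKer_of_isSquare (E.quadraticTwist d) h' _
            (charZero_of_injective_algebraMap (algebraMap ℚ _).injective) _ _ ?_ ?_
          · rw [Units.val_mul, Units.val_mk0]
            refine sq hA0 ?_ ?_
            · rw [parityBit_mul t₁.ne_zero hpa0, hpt₁, hpA]; decide
            · rw [qrBit_mul j t₁.ne_zero hpa0, hτ₁, hresA]
              linear_combination (norm := skip) r1
              ring_nf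
              try reduce_mod_char
              try simp
          · rw [Units.val_mul, Units.val_mk0]
            refine sq hB0 ?_ ?_
            · rw [parityBit_mul t₂.ne_zero hpb0, hpt₂, hpB]; decide
            · rw [qrBit_mul j t₂.ne_zero hpb0, hτ₂, hresB]
              linear_combination (norm := skip) r2
              ring_nf
              try reduce_mod_char
              try simp
      · -- `ℓ ∉ S ∪ Q`: good reduction of the twist, unit components
        have hD0 : (∏ q ∈ Q, (q : ℤ)) ≠ 0 :=
          Finset.prod_ne_zero_iff.mpr fun q hq => by exact_mod_cast (hQ q hq).ne_zero
        have hℓD : ¬ ((primesEquiv v : ℕ) : ℤ) ∣ ∏ q ∈ Q, (q : ℤ) := by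
          intro hdvd
          obtain ⟨i, hi, hℓi⟩ := (Prime.dvd_finsetProd_iff (Nat.prime_iff_prime_int.mp hℓ) _).mp hdvd
          have := (Nat.prime_dvd_prime_iff_eq hℓ (hQ i hi)).mp (by exact_mod_cast hℓi)
          exact hvQ (this ▸ hi)
        have hgoodv : (E.quadraticTwist d).HasGoodReductionAt v := by
          by_contra hbad
          have hdvd := ((E.quadraticTwist d).dvd_conductorNorm_iff v).mpr hbad
          have hnot := not_dvd_conductorNorm_quadraticTwist_of_not_dvd E hℓ hℓ2 (hN _ hℓ hvS) hD0 hℓD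
          rw [show (((∏ q ∈ Q, (q : ℤ)) : ℤ) : ℚ) = d by rw [hd]; push_cast; rfl] at hnot
          exact hnot hdvd
        exact (E.quadraticTwist d).twoDescentClass_mem_selmerLocalKer_of_mk_eq_intCast h' v hℓ2 hgoodv _ _ mA mB hmA0 hmB0
          hmkA hmkB (hmAdiv _ hℓ hvS hvQ) (hmBdiv _ hℓ hvS hvQ)
  · -- the real place
    have hdpos : 0 < d := by rw [hd]; exact Finset.prod_pos fun q hq => by exact_mod_cast (hQ q hq).pos
    have hpapos : 0 < ∏ i ∈ Qa, (i : ℚ) := Finset.prod_pos fun i hi => by exact_mod_cast (hQ i (hQa hi)).pos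
    have hpbpos : 0 < ∏ i ∈ Qb, (i : ℚ) := Finset.prod_pos fun i hi => by exact_mod_cast (hQ i (hQb hi)).pos
    rw [hsplit]
    refine add_mem ?_ ?_
    · exact (E.twoDescentClass_quadraticTwist_mem_selmerLocalKer_iff w.Completion
        (charZero_of_injective_algebraMap (algebraMap ℚ _).injective) h (isSquare_algebraMap_completion_of_pos w hdpos)
        t₁ t₂).mpr (htloc.2 w)
    · exact twoDescentClass_mem_selmerLocalKer_of_isSquare (E.quadraticTwist d) h' _
        (charZero_of_injective_algebraMap (algebraMap ℚ _).injective) _ _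
        (isSquare_algebraMap_completion_of_pos w hpapos) (isSquare_algebraMap_completion_of_pos w hpbpos)

end Converse

end Summit.BirchSwinnertonDyer.BirchSwinnertonDyer.Theorems.GenusKolyvaginAtTwo.TorsionCellSEL

end
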